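import Summits.CriticalPhenomena.PercolationContinuityZ3.Theorems.PercNearOneGluingNoHeavyPcintNawRandMemKernel
import HarnessLib

/-!
# PCINT lane, reduced-state B2r certificates: tables, the row check, and the kernel certificate theorem

Cell `prim-pcint` (PAPER-2 track (iii)), seat `prim-pcint-1` (gen 5); support file (`--supports stmt-CriticalPhenomena-4575`).
Does NOT build on p205010.  A certificate is a search tree `NawK.NT` keyed by row index whose payload is
(weight `V`, state, per-letter successor datum `(row, symmetry number)`); `NawK.checkRow τ d N pn Q D lamN lamD syms t i`
recomputes the step of row `i` at every letter, matches it against the listed datum up to the listed symmetry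
(`NawK.termOK`), and checks the integer Collatz–Wielandt inequality `lamD · Σ_a pn·Q^g·D^{2d-g}·(D+Q ‖ 2D)·V_j ≤
lamN · 2 · D^{2d+2} · V_i` (`NawK.termVal`, `NawK.rowVal`).  **`NawK.le_siteCriticalProb_of_checkRows`**: if all rows
`i < N` pass, row `0` is the empty state, the symmetry numbers denote lattice symmetries, `pn ≤ D`, `Q ≤ D`,
`(D-pn)·D^{2d-2} ≤ Q^{2d-1}`, `lamN < lamD`, then `pn/D ≤ p_c^site(ℤ^d)` (via `le_siteCriticalProb_zd_of_nawMemTable`).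
Instances: `…PcintNawMemZ3M12*` (`p_c^site(ℤ³) ≥ 1/4`).
-/

namespace Summit.CriticalPhenomena.PercolationContinuityZ3.Theorems.Pcint

open Finset Literature.Probability.Percolation Literature.Probability.LatticeModels

namespace NawK

open WinK (toSite toL addL adjL toSite_addL toSite_toL adj_iff_adjL toSite_inj length_toL length_addL)

variable {d : ℕ}

/-! ### Tables and row checks -/

/-- Row payload: Collatz–Wielandt weight, state, and per-letter successor data (row index, symmetry number). [folklore] -/
abbrev Payload : Type := ℕ × KState × List (Option (ℕ × ℕ))

/-- Certificate table as a search tree keyed by row index. [folklore] -/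
inductive NT where
  | leaf : NT
  | node : NT → ℕ → Payload → NT → NT

/-- Lookup by row index (no ordering invariant is assumed: the lookup function IS the table). [folklore] -/
def NT.find (i : ℕ) : NT → Option Payload
  | NT.leaf => none
  | NT.node l k v r => if i < k then l.find i else if k < i then r.find i else some v

/-- Grafting: a tree whose lookups below `k` go to `l` and above `k` to `r` (for splitting big tables over files).
[folklore] -/
theorem NT.find_node (l r : NT) (k : ℕ) (v : Payload) (i : ℕ) :
    (NT.node l k v r).find i = if i < k then l.find i else if k < i then r.find i else some v := rfl

/-- The position of a letter in `letters d`. [folklore] -/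
def letterIdx (a : Fin d × Bool) : ℕ := 2 * a.1.1 + (if a.2 then 0 else 1)

section Check

variable (τ d N pn Q D lamN lamD : ℕ) (syms : List (List (ℕ × Bool))) (t : NT)

/-- The state of row `i` (empty if absent). [folklore] -/
def stOf (i : ℕ) : KState := match t.find i with
  | some v => v.2.1
  | none => []

/-- The weight of row `i` (`1` if absent). [folklore] -/
def vOf (i : ℕ) : ℕ := match t.find i with
  | some v => v.1
  | none => 1

/-- The successor datum of row `i` at letter number `k`. [folklore] -/
def scOf (i k : ℕ) : Option (ℕ × ℕ) := match t.find i with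
  | some v => (v.2.2.getD k none)
  | none => none

/-- The MATCH test of one letter of a row: a recomputed rejection must be listed as a rejection; a recomputed successor
must be, as a set, the listed row's state moved by the listed symmetry. [folklore] -/
def termOK (L : KState) (a : Fin d × Bool) (os : Option (ℕ × ℕ)) : Bool :=
  match nstepK τ d L a, os with
  | none, none => true
  | some T, some (j, c) => decide (j < N) && decide (c < syms.length) && seteqK T (actK (syms.getD c []) (stOf t j))
  | _, _ => false

/-- The integer value of one letter of a row: `pn · Q^g · D^{2d-g} · (D+Q ‖ 2D) · V_j` for a listed successor `j`
(`g`, corner flag recomputed from the row's state), `0` for a listed rejection. [folklore] -/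
def termVal (L : KState) (a : Fin d × Bool) (os : Option (ℕ × ℕ)) : ℕ :=
  match os with
  | none => 0
  | some jc => pn * Q ^ ngapK d L a * D ^ (2 * d - ngapK d L a) * (if ncornerK d L a then D + Q else 2 * D) * vOf t jc.1

/-- The integer row sum. [folklore] -/
def rowVal (L : KState) (sc : ℕ → Option (ℕ × ℕ)) : ℕ := ((letters d).map fun a => termVal d pn Q D t L a (sc (letterIdx a))).sum

/-- **The row check**: the row exists, its state is well formed, its weight is positive, every letter matches the
recomputed step, and the integer Collatz–Wielandt inequality `lamD · Σ ≤ lamN · 2 · D^{2d+2} · V` holds. [folklore] -/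
def checkRow (i : ℕ) : Bool :=
  match t.find i with
  | none => false
  | some v =>
    WF d v.2.1 && decide (1 ≤ v.1) &&
      (letters d).all (fun a => termOK τ d N syms t v.2.1 a (v.2.2.getD (letterIdx a) none)) &&
      decide (lamD * rowVal d pn Q D t v.2.1 (fun k => v.2.2.getD k none) ≤ lamN * 2 * D ^ (2 * d + 2) * v.1)

end Check

/-! ### Soundness: checked rows bound `p_c^site(ℤ^d)` from below -/

section Sound

variable {τ d N pn Q D lamN lamD : ℕ} {syms : List (List (ℕ × Bool))} {t : NT}

/-- Sums over the letter list are sums over all letters. [folklore] -/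
theorem sum_letters_eq {M : Type*} [AddCommMonoid M] (f : Fin d × Bool → M) : ((letters d).map f).sum = ∑ a, f a := by
  classical
  rw [← List.sum_toFinset f nodup_letters]
  congr 1
  ext a
  simp only [List.mem_toFinset, Finset.mem_univ, iff_true]
  exact mem_letters a

/-- The letter list has `2d` entries. [folklore] -/
theorem length_letters : (letters d).length = 2 * d := by
  have h := sum_letters_eq (d := d) (fun _ => (1 : ℕ))
  simp only [List.map_const', List.sum_replicate, smul_eq_mul, mul_one, Finset.sum_const, Finset.card_univ,
    Fintype.card_prod, Fintype.card_fin, Fintype.card_bool] at h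
  omega

/-- The kernel gap count is at most `2d`. [folklore] -/
theorem ngapK_le (L : KState) (a : Fin d × Bool) : ngapK d L a ≤ 2 * d :=
  (List.length_filter_le _ _).trans length_letters.le

/-- What a passed row check says. [folklore] -/
theorem checkRow_spec {i : ℕ} (h : checkRow τ d N pn Q D lamN lamD syms t i = true) :
    ∃ v, t.find i = some v ∧ WF d v.2.1 = true ∧ 1 ≤ v.1 ∧
      (∀ a, termOK τ d N syms t v.2.1 a (v.2.2.getD (letterIdx a) none) = true) ∧
      lamD * rowVal d pn Q D t v.2.1 (fun k => v.2.2.getD k none) ≤ lamN * 2 * D ^ (2 * d + 2) * v.1 := by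
  unfold checkRow at h
  cases hf : t.find i with
  | none => rw [hf] at h; exact Bool.noConfusion h
  | some v =>
    rw [hf] at h
    simp only [Bool.and_eq_true, decide_eq_true_eq, List.all_eq_true] at h
    obtain ⟨⟨⟨hwf, hv⟩, hall⟩, hineq⟩ := h
    exact ⟨v, rfl, hwf, hv, fun a => hall a (mem_letters a), hineq⟩

/-- The real value of an integer letter term. [folklore] -/
theorem termVal_real_eq {g F Vj : ℕ} (hg : g ≤ 2 * d) (hD : (0 : ℝ) < D) :
    ((pn * Q ^ g * D ^ (2 * d - g) * F * Vj : ℕ) : ℝ) / (2 * (D : ℝ) ^ (2 * d + 2)) =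
      (pn : ℝ) / D * ((Q : ℝ) / D) ^ g * ((F : ℝ) / (2 * D)) * Vj := by
  have hsplit : (D : ℝ) ^ (2 * d + 2) = (D : ℝ) ^ (2 * d - g) * (D : ℝ) ^ g * (D : ℝ) ^ 2 := by
    rw [← pow_add, ← pow_add]; congr 1; omega
  rw [hsplit, div_pow]
  push_cast
  field_simp

/-- **Soundness of the kernel certificate.**  If every row `i < N` of the table passes `checkRow`, row `0` carries the
empty state, the symmetry numbers denote lattice symmetries (`syms c = spermKL (sym c)`), and the constants satisfy
`pn ≤ D`, `Q ≤ D`, `(D - pn)·D^{2d-2} ≤ Q^{2d-1}` (i.e. `q̄^{2d-1} ≥ 1 - p` for `q̄ = Q/D`), `lamN < lamD`, then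
`pn / D ≤ p_c^site(ℤ^d)`. [folklore] -/
theorem le_siteCriticalProb_of_checkRows [NeZero d] (hτ : 2 ≤ τ) (sym : ℕ → SPerm d)
    (hsyms : ∀ c < syms.length, syms.getD c [] = spermKL (sym c))
    (hrows : ∀ i < N, checkRow τ d N pn Q D lamN lamD syms t i = true)
    (hN : 0 < N) (h0 : stOf t 0 = []) (hD : 0 < D) (hpn : pn ≤ D) (hQ : Q ≤ D)
    (hq : (D - pn) * D ^ (2 * d - 2) ≤ Q ^ (2 * d - 1)) (hlam : lamN < lamD) :
    (pn : ℝ) / D ≤ siteCriticalProb (zdGraph d) 0 := by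
  classical
  have hd : 1 ≤ d := NeZero.one_le
  have hDr : (0 : ℝ) < D := Nat.cast_pos.2 hD
  have hlamDr : (0 : ℝ) < lamD := Nat.cast_pos.2 (by omega)
  -- the constants
  set p : unitInterval := ⟨(pn : ℝ) / D, div_nonneg (Nat.cast_nonneg _) hDr.le,
    div_le_one_of_le₀ (by exact_mod_cast hpn) hDr.le⟩ with hp
  set qb : ℝ := (Q : ℝ) / D with hqb
  set κb : ℝ := ((D : ℝ) + Q) / (2 * D) with hκb
  set lam : ℝ := (lamN : ℝ) / lamD with hlamdef
  have hqb0 : 0 ≤ qb := div_nonneg (Nat.cast_nonneg _) hDr.le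
  have hqb1 : qb ≤ 1 := div_le_one_of_le₀ (by exact_mod_cast hQ) hDr.le
  have hκ : (1 + qb) / 2 ≤ κb := by rw [hκb, hqb]; apply le_of_eq; field_simp
  have hQr : (Q : ℝ) ≤ D := by exact_mod_cast hQ
  have hκb1 : κb ≤ 1 := by rw [hκb, div_le_one (by positivity)]; linarith
  have hlam0 : 0 ≤ lam := div_nonneg (Nat.cast_nonneg _) hlamDr.le
  have hlam1 : lam < 1 := (div_lt_one hlamDr).2 (by exact_mod_cast hlam)
  have hpq : 1 - (p : ℝ) ≤ qb ^ (2 * d - 1) := by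
    have key : ((D : ℝ) - pn) * (D : ℝ) ^ (2 * d - 2) ≤ (Q : ℝ) ^ (2 * d - 1) := by
      have h1 : (((D - pn : ℕ) : ℝ)) = (D : ℝ) - pn := Nat.cast_sub hpn
      rw [← h1]; exact_mod_cast hq
    have e1 : 1 - (p : ℝ) = ((D : ℝ) - pn) / D := by
      show 1 - (pn : ℝ) / D = _; field_simp
    rw [e1, hqb, div_pow, div_le_div_iff₀ hDr (pow_pos hDr _)]
    calc ((D : ℝ) - pn) * (D : ℝ) ^ (2 * d - 1) = ((D : ℝ) - pn) * (D : ℝ) ^ (2 * d - 2) * D := by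
          rw [show 2 * d - 1 = 2 * d - 2 + 1 by omega, pow_succ]; ring
      _ ≤ (Q : ℝ) ^ (2 * d - 1) * D := mul_le_mul_of_nonneg_right key hDr.le
  -- the semantic table
  let R : Fin N → MState d := fun i => toM (stOf t i)
  let V : Fin N → ℝ := fun i => (vOf t i : ℝ)
  let sc : Fin N → Fin d × Bool → Option (Fin N × SPerm d) := fun i a =>
    match scOf t i (letterIdx a) with
    | none => none
    | some jc => if h : jc.1 < N then some ((⟨jc.1, h⟩ : Fin N), sym jc.2) else none
  -- row data
  have hrow : ∀ i : Fin N, ∃ v, t.find i = some v ∧ WF d v.2.1 = true ∧ 1 ≤ v.1 ∧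
      (∀ a, termOK τ d N syms t v.2.1 a (v.2.2.getD (letterIdx a) none) = true) ∧
      lamD * rowVal d pn Q D t v.2.1 (fun k => v.2.2.getD k none) ≤ lamN * 2 * D ^ (2 * d + 2) * v.1 :=
    fun i => checkRow_spec (hrows i i.2)
  have hst : ∀ (i : Fin N) v, t.find i = some v → stOf t i = v.2.1 := fun i v h => by simp [stOf, h]
  have hv : ∀ (i : Fin N) v, t.find i = some v → vOf t i = v.1 := fun i v h => by simp [vOf, h]
  have hsc : ∀ (i : Fin N) v, t.find i = some v → ∀ k, scOf t i k = v.2.2.getD k none := fun i v h k => by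
    simp [scOf, h]
  have hV : ∀ i, 1 ≤ V i := fun i => by
    obtain ⟨v, hf, -, hv1, -⟩ := hrow i
    show (1 : ℝ) ≤ (vOf t i : ℝ)
    rw [hv i v hf]; exact_mod_cast hv1
  have h0' : R ⟨0, hN⟩ = ∅ := by
    show toM (stOf t 0) = (∅ : MState d)
    rw [h0]; rfl
  -- simulation
  have hsim : ∀ i a, simRel R (nstep τ (R i) a) (sc i a) = true := by
    intro i a
    obtain ⟨v, hf, hwf, -, hok, -⟩ := hrow i
    have hRi : R i = toM v.2.1 := by show toM (stOf t i) = _; rw [hst i v hf]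
    have hoka := hok a
    unfold termOK at hoka
    have hsci : sc i a = (match v.2.2.getD (letterIdx a) none with
        | none => none
        | some jc => if h : jc.1 < N then some ((⟨jc.1, h⟩ : Fin N), sym jc.2) else none) := by
      show (match scOf t i (letterIdx a) with
        | none => none
        | some jc => if h : jc.1 < N then some ((⟨jc.1, h⟩ : Fin N), sym jc.2) else none) = _
      rw [hsc i v hf]
    rw [hRi, nstep_toM hwf, hsci]
    cases hT : nstepK τ d v.2.1 a with
    | none =>
      rw [hT] at hoka
      cases hos : v.2.2.getD (letterIdx a) none with
      | none => rfl
      | some jc => rw [hos] at hoka; exact Bool.noConfusion hoka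
    | some T =>
      rw [hT] at hoka
      cases hos : v.2.2.getD (letterIdx a) none with
      | none => rw [hos] at hoka; exact Bool.noConfusion hoka
      | some jc =>
        rw [hos] at hoka
        rcases jc with ⟨j, c⟩
        simp only [Bool.and_eq_true, decide_eq_true_eq] at hoka
        obtain ⟨⟨hjN, hc⟩, hseq⟩ := hoka
        simp only [Option.map_some, dif_pos hjN, simRel, decide_eq_true_eq]
        rw [toM_eq_of_seteqK hseq, hsyms c hc, toM_actK]
  -- Collatz–Wielandt rows
  have hcw : ∀ i, (∑ a : Fin d × Bool, match sc i a with
      | none => 0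
      | some jg => (p : ℝ) * nwt qb κb (R i) a * V jg.1) ≤ lam * V i := by
    intro i
    obtain ⟨v, hf, hwf, hv1, hok, hineq⟩ := hrow i
    have hRi : R i = toM v.2.1 := by show toM (stOf t i) = _; rw [hst i v hf]
    -- each summand is at most the integer term over 2·D^{2d+2}
    have hterm : ∀ a, (match sc i a with
        | none => 0
        | some jg => (p : ℝ) * nwt qb κb (R i) a * V jg.1) ≤
        (termVal d pn Q D t v.2.1 a (v.2.2.getD (letterIdx a) none) : ℝ) / (2 * (D : ℝ) ^ (2 * d + 2)) := by
      intro a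
      have hoka := hok a
      unfold termOK at hoka
      have hsci : sc i a = (match v.2.2.getD (letterIdx a) none with
          | none => none
          | some jc => if h : jc.1 < N then some ((⟨jc.1, h⟩ : Fin N), sym jc.2) else none) := by
        show (match scOf t i (letterIdx a) with
          | none => none
          | some jc => if h : jc.1 < N then some ((⟨jc.1, h⟩ : Fin N), sym jc.2) else none) = _
        rw [hsc i v hf]
      rw [hsci]
      cases hos : v.2.2.getD (letterIdx a) none with
      | none => simp only [termVal, Nat.cast_zero, zero_div, le_refl]
      | some jc =>
        rw [hos] at hoka
        cases hT : nstepK τ d v.2.1 a with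
        | none => rw [hT] at hoka; exact Bool.noConfusion hoka
        | some T =>
          rw [hT] at hoka
          rcases jc with ⟨j, c⟩
          simp only [Bool.and_eq_true, decide_eq_true_eq] at hoka
          obtain ⟨⟨hjN, -⟩, -⟩ := hoka
          simp only [dif_pos hjN, termVal]
          rw [termVal_real_eq (ngapK_le _ _) hDr]
          -- compare factor by factor
          have hVj : V ⟨j, hjN⟩ = (vOf t j : ℝ) := rfl
          rw [hVj, hRi]
          have hg := ngapK_le_ngap hwf a (d := d)
          have hpow : qb ^ ngap (toM v.2.1 : MState d) a ≤ ((Q : ℝ) / D) ^ ngapK d v.2.1 a :=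
            pow_le_pow_of_le_one hqb0 hqb1 hg
          have hcf : (if ncorner (toM v.2.1 : MState d) a then κb else 1) ≤
              (((if ncornerK d v.2.1 a then D + Q else 2 * D : ℕ) : ℝ) / (2 * D)) := by
            by_cases hcK : ncornerK d v.2.1 a = true
            · rw [if_pos (ncorner_of_ncornerK hwf a hcK), if_pos hcK, hκb]; push_cast; exact le_rfl
            · rw [if_neg hcK]
              have e2 : (((2 * D : ℕ) : ℝ)) / (2 * D) = 1 := by push_cast; field_simp
              rw [e2]
              split_ifs
              · exact hκb1
              · exact le_rfl
          have hp0 : (0 : ℝ) ≤ (pn : ℝ) / D := div_nonneg (Nat.cast_nonneg _) hDr.le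
          show (pn : ℝ) / D * (qb ^ ngap (toM v.2.1 : MState d) a * (if ncorner (toM v.2.1 : MState d) a then κb else 1)) *
              (vOf t j : ℝ) ≤ _
          calc (pn : ℝ) / D * (qb ^ ngap (toM v.2.1 : MState d) a *
                (if ncorner (toM v.2.1 : MState d) a then κb else 1)) * (vOf t j : ℝ)
              ≤ (pn : ℝ) / D * (((Q : ℝ) / D) ^ ngapK d v.2.1 a *
                ((((if ncornerK d v.2.1 a then D + Q else 2 * D : ℕ) : ℝ) / (2 * D)))) * (vOf t j : ℝ) := by
                refine mul_le_mul_of_nonneg_right (mul_le_mul_of_nonneg_left (mul_le_mul hpow hcf ?_ ?_) hp0)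
                  (Nat.cast_nonneg _)
                · split_ifs
                  · rw [hκb]; positivity
                  · exact zero_le_one
                · positivity
            _ = _ := by ring
    calc (∑ a : Fin d × Bool, match sc i a with
            | none => 0
            | some jg => (p : ℝ) * nwt qb κb (R i) a * V jg.1)
        ≤ ∑ a : Fin d × Bool, (termVal d pn Q D t v.2.1 a (v.2.2.getD (letterIdx a) none) : ℝ) / (2 * (D : ℝ) ^ (2 * d + 2)) :=
          Finset.sum_le_sum fun a _ => hterm a
      _ = (rowVal d pn Q D t v.2.1 (fun k => v.2.2.getD k none) : ℝ) / (2 * (D : ℝ) ^ (2 * d + 2)) := by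
          rw [← Finset.sum_div, rowVal, ← sum_letters_eq, Nat.cast_list_sum, List.map_map]; rfl
      _ ≤ lam * V i := by
          rw [div_le_iff₀ (by positivity), hlamdef]
          show _ ≤ (lamN : ℝ) / lamD * (vOf t i : ℝ) * (2 * (D : ℝ) ^ (2 * d + 2))
          rw [hv i v hf, div_mul_eq_mul_div, div_mul_eq_mul_div, le_div_iff₀ hlamDr]
          have := hineq
          calc (rowVal d pn Q D t v.2.1 (fun k => v.2.2.getD k none) : ℝ) * lamD
              = ((lamD * rowVal d pn Q D t v.2.1 (fun k => v.2.2.getD k none) : ℕ) : ℝ) := by push_cast; ring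
            _ ≤ ((lamN * 2 * D ^ (2 * d + 2) * v.1 : ℕ) : ℝ) := by exact_mod_cast hineq
            _ = (lamN : ℝ) * (v.1 : ℝ) * (2 * (D : ℝ) ^ (2 * d + 2)) := by push_cast; ring
  have main := le_siteCriticalProb_zd_of_nawMemTable (d := d) hτ p hqb0 le_rfl hqb1 hκ hpq hlam0 hlam1
    R sc V ⟨0, hN⟩ h0' hV hsim hcw
  exact main

end Sound


end NawK

end Summit.CriticalPhenomena.PercolationContinuityZ3.Theorems.Pcint
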